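import Summits.QuantumFields.BalabanUV.Beta.FP.TowerDoorDefectDefs
import Summits.QuantumFields.BalabanUV.Beta.FP.TowerDoorRecordDefsG
import Summits.QuantumFields.BalabanUV.Beta.CompositeOneShotJetsGraded
import Summits.QuantumFields.BalabanUV.Beta.CombMixedT2EvenGradedPeriodised

/-!
# `BalabanUV.Beta.FP.TowerDoorDefectGraded` — row D1 ∕ (C1) OWNER «beta-an2», PART 95, v11 (T1): **AT THE GRADED RECORD THE WARD-DEFECT KERNEL IS A PURE COMMUTATOR
# TIMES `(−wM2 − κ₂)`, HENCE ZERO AT THE LOCKED WEIGHT — AND SO IS THE GRADED DOOR** (journal [AN2-G84-W-2] FINDING AN2-84-1 (ii), now BY NAME)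

WHY.  Under (T1) the END instantiates its door at the GRADED table record (V11-DELTA-2 Δ4, A2-ROW-v11 §5): `𝒲Δ := doorRecG Lc Q (tabsRecG Lc Pn) sn cS κ₂ κτ`, whose member
`n+1` is `doorZ (Lc^(n+2)) (tabsRecG Lc Pn n) (κ₂ n) (κτ n) (lamRecG …) (SRec …)` (PART 87 `doorRecG_succ`), the `S`-weighted superposition of the Ward-defect kernels
`defKerZ (Lc^(n+2)) (tabsRecG Lc Pn n) (κ₂ n) v β` (PART 62).  For the GRADED mixed table (F0) `compMixG` the pure-gauge row is ONE commutator with NO remainder — an1 PART 78b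
`tsum_sum_grad_mul_compMixKerG_even` on the lattice, summed by parts into the SITE LAW 79b `CombMixedT2EvenGradedPeriodised.sum_compMixedT2G_even_sub_inl_inl`:
`Σ_κ (M2ᴳᵉ κ (w₀−e_κ) − M2ᴳᵉ κ w₀) x z (inl α) (inl γ) = ([x = w₀] − [z = w₀])·(−wM2·Ĉ⁽ᵐ⁾(α,x;γ,z))`.  THIS FILE reads that site law back against an ARBITRARY gauge function `v`
(GAN24 `tsum_sum_dz_mul_eq`, summation by parts; the mixed table's fine-bond window makes every sum finite) and finds the defect kernel's `ff` entries IN CLOSED FORM: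
`defKerZ (Lc^(n+2)) (tabsRecG Lc Pn n) κ₂ v β x w (inl α) (inl α′) = (−wM2 3 (Lc^(n+2)) 0 − κ₂) · ((v x − v w) · Ĉ_β (α,x;α′,w))` — a PURE COMMUTATOR of the multiplication
operator `E_v` with the composite constraint Hessian `Ĉ_β := compVHKer ℓˢ 𝒽ˢ Lc (n+2) β.2 β.1`, with the scalar `(−wM2 − κ₂)`; so at the weight `κ₂ = −wM2 3 (Lc^(n+2)) 0` the defect
kernel VANISHES IDENTICALLY (every leg: the multiplier legs are `0` by definition), and with it the graded door `doorZ … (tabsRecG …) …` and `doorRecG … (tabsRecG Lc Pn) …` at every member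
whose `κ₂ n` is that weight.  CONSEQUENCE (journal [AN2-G84-W-2] (B)(ii)(iii), zero weight on any binder): under (T1) the door AS INSTANTIATED is the zero family — NOT the
object that absorbs the graded-minus-ungraded cross word `WNG − WN`; that one is the END consumer's to carry (`…PairingSummable` L.358–360 pins `WN Rt P j + 𝒲Δ j`).

WHAT ([folklore] `tsum`∕`Finset` bookkeeping BY NAME over PART 62's definitions and 79b's site law; no `def`, no `def … : Prop`, nothing cited, 0 sorry, default heartbeats):
§1 `tabsRecG_H_inl_inl` (`rfl`), `M2Z_tabsRecG` (`rfl`: the graded record's `M2Z` IS 79b's even graded table at weight index `0`);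
§2 **`defKerZ_tabsRecG_inl_inl`** (the closed form), **`defKerZ_tabsRecG_eq_smul_comm`** (all legs), **`defKerZ_tabsRecG_eq_zero`** (`κ₂ = −wM2 3 (Lc^(n+2)) 0`);
§3 **`doorZ_tabsRecG_eq_zero`**, **`doorRecG_tabsRecG_succ_eq_zero`** (the graded door's member `n+1` vanishes at the locked weight; member `0` is `0` by definition).
WHAT THIS IS NOT: not a claim that v10∕v11's `κ₂ n` IS `−wM2 3 (Lc^(n+2)) 0` (that is the END's lock `hLk : c n·Pn.cΛ (n+2) = sn n·cM₂ n·r n·κ₂ n` read against the pins — a DISPLAYED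
relation; the theorems here take the equality as a hypothesis, and give the closed form `(−wM2 − κ₂)•commutator` WITHOUT it); not the door's pairing letters (PART 74∕89, road R4a′∕R4b′ —
they hold for any door); not `hX′` of FINDING AN2-84-1 (iv); nothing of Bałaban's asserted, valued or discharged; 0 estimates; 0∕4 row-D1 binders (hW, hR, D1Tel, D1Rep); ROOT M‴ p325680 ∕
P5c ∕ D6 untouched; NOT (C1), NOT (T-ID), NOT D1, NEVER «G-an2-4 closed», NOT BetaPertH, NOT continuum, NOT Clay.

HONEST DEPENDENCY (page 1, mandatory): continuum YM on T⁴ ⇐ BetaPertH ∧ nine spine estimates (0/9 proved); BetaPertH ⇐ (D1) ∧ (D4) ∧ CAP+tail;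
G-an2-4 gates asym, D1 and NE2/3/4.  HONEST FRAMING (cell contract, verbatim): «discharging `BetaPertH` makes Bałaban's UV stability UNCONDITIONAL —
a real constructive-QFT result; it is NOT the continuum limit and NOT the Clay problem.»  ABSOLUTE RULE (cell charter, verbatim): «No internally-minted
statement may enter as a cited fact. Every hypothesis is either kernel-proved in this package or a verbatim quotation of a PUBLISHED theorem with page
reference. The manuscript(s) under audit are NOT citable for their own disputed steps — they are the thing under adjudication; programme-internal
(2001/route/tribunal) claims are never citable.»  Row D1 ∕ (C1) OWNER «beta-an2», b2b-balaban-beta-an2 gen 84, 2026-08-30.  No existing file touched.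
-/

noncomputable section

open scoped BigOperators

namespace Summit.QuantumFields.BalabanUV.Beta.FP.TowerDoorDefectGraded

open Finset
open Literature.MathematicalPhysics.QuantumFieldTheory
open Literature.MathematicalPhysics.QuantumFieldTheory.Balaban1983to89
open Literature.MathematicalPhysics.QuantumFieldTheory.Balaban1983to89.Beta
open ExpKernelCalculus (MKer)
open AffineAveraging (Site unitVec dz)
open AveragingContoursRooted (ctr ctrOff)
open OneStepResolventKernel (Fib)
open BalabanStepW2 (M2Of wM2)
open Summit.QuantumFields.BalabanUV.Beta.TameKernelCalculus (trK)
open Summit.QuantumFields.BalabanUV.Beta.BorderedHessian (sgnK)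
open Summit.QuantumFields.BalabanUV.Beta.SymAveragingHessianCounts (symLinKerAt symHessKerAt)
open Summit.QuantumFields.BalabanUV.Beta.CompositeVertexKernelRec (winF wid compVHKer)
open Summit.QuantumFields.BalabanUV.Beta.CompositeMixedTableGraded (compMixG)
open Summit.QuantumFields.BalabanUV.Beta.CompositeOneShotJetData (Pins Roots Roots.ctr)
open Summit.QuantumFields.BalabanUV.Beta.CompositeOneShotJetsGraded (tabsRecG)
open Summit.QuantumFields.BalabanUV.Beta.CombMixedT2EvenGradedPeriodised (sum_compMixedT2G_even_sub_inl_inl compMixedT2G_even_inl_inl_eq_zero_of_bond)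
open Summit.QuantumFields.BalabanUV.Beta.GAN24.BorderGaugeLegContact (tsum_sum_dz_mul_eq)
open Summit.QuantumFields.BalabanUV.Beta.FP.TowerDoorDefectDefs (M2Z defKerZ doorZ defKerZ_apply_inl_inl defKerZ_inr_left defKerZ_inr_right doorZ_apply)
open Summit.QuantumFields.BalabanUV.Beta.FP.TowerDoorRecordDefsG (lamRecG doorRecG doorRecG_succ)
open Summit.QuantumFields.BalabanUV.Beta.FP.TowerDoorRecordDefs (SRec)
open Summit.QuantumFields.BalabanUV.Beta.FP.TorusCompositeObjectsG (StepRows)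

variable {Lc : ℕ} [NeZero Lc] (Pn : Pins) (n : ℕ)

/-! ## §1 The graded record's two slots on the `ff` block (`rfl`) -/

/-- [folklore] the Hessian slot of the graded record on the `(inl, inl)` block IS the depth-`(n+2)` composite constraint Hessian over an1's sym bricks at the centred root
(`tabsRecG_H` ∘ `tabsComp_H` ∘ `compHessFF_inl_inl`; `(Roots.ctr Lc).r = ctrOff 4 Lc`, `toSite (ctrOff 4 Lc) = ctr 4 Lc` — all `rfl`). -/
theorem tabsRecG_H_inl_inl (ρ : Fin (3 + 1)) (y x w : Site (3 + 1)) (α α' : Fin (3 + 1)) :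
    (tabsRecG Lc Pn n).H ρ y x w (Sum.inl α) (Sum.inl α')
      = compVHKer (fun _ => symLinKerAt (ctr 4 Lc) Lc) (fun _ => symHessKerAt (ctr 4 Lc) Lc) Lc (n + 1 + 1) ρ y (α, x) (α', w) := rfl

/-- [folklore] the graded record's symmetrised mixed table `M2Z` at the fine bond `(u, κ)` and the window `β` IS 79b's even graded table at weight index `0` (`tabsRecG_mixFF`, `rfl`). -/
theorem M2Z_tabsRecG (u : Site (3 + 1)) (κ : Fin (3 + 1)) (β : Site (3 + 1) × Fin (3 + 1)) :
    M2Z (Lc ^ (n + 1 + 1)) (tabsRecG Lc Pn n) (u, κ) β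
      = (1 / 2 : ℝ) • (M2Of 3 (Lc ^ (n + 1 + 1)) (compMixG (ctrOff (3 + 1) Lc) Lc (n + 1 + 1)) 0 κ u β.2 β.1
          + sgnK (trK (M2Of 3 (Lc ^ (n + 1 + 1)) (compMixG (ctrOff (3 + 1) Lc) Lc (n + 1 + 1)) 0 κ u β.2 β.1))) := rfl

/-! ## §2 The defect kernel at the graded record: closed form, and zero at the locked weight -/

/-- [folklore] **`defKerZ_tabsRecG_inl_inl` — THE WARD-DEFECT KERNEL AT THE GRADED RECORD IS `(−wM2 − κ₂)` TIMES A PURE COMMUTATOR** on the `ff` block: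
`defKerZ (Lc^(n+2)) (tabsRecG Lc Pn n) κ₂ v β x w (inl α) (inl α′) = (−wM2 3 (Lc^(n+2)) 0 − κ₂) · ((v x − v w) · Ĉ_β(α,x;α′,w))`, `Ĉ_β := compVHKer ℓˢ 𝒽ˢ Lc (n+2) β.2 β.1`
(79b's site law `sum_compMixedT2G_even_sub_inl_inl` read against `v` by GAN24's summation by parts `tsum_sum_dz_mul_eq`; the fine-bond window
`compMixedT2G_even_inl_inl_eq_zero_of_bond` makes every sum finite). -/
theorem defKerZ_tabsRecG_inl_inl (κ₂ : ℝ) (v : Site (3 + 1) → ℝ) (β : Site (3 + 1) × Fin (3 + 1)) (x w : Site (3 + 1)) (α α' : Fin (3 + 1)) :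
    defKerZ (Lc ^ (n + 1 + 1)) (tabsRecG Lc Pn n) κ₂ v β x w (Sum.inl α) (Sum.inl α')
      = (-(wM2 3 (Lc ^ (n + 1 + 1)) 0) - κ₂)
          * ((v x - v w) * compVHKer (fun _ => symLinKerAt (ctr 4 Lc) Lc) (fun _ => symHessKerAt (ctr 4 Lc) Lc) Lc (n + 1 + 1) β.2 β.1 (α, x) (α', w)) := by
  rw [defKerZ_apply_inl_inl, tabsRecG_H_inl_inl]
  -- the even graded table's `ff` entry as a function of the fine bond
  set F : Fin (3 + 1) → Site (3 + 1) → ℝ := fun κ u =>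
    ((1 / 2 : ℝ) • (M2Of 3 (Lc ^ (n + 1 + 1)) (compMixG (ctrOff (3 + 1) Lc) Lc (n + 1 + 1)) 0 κ u β.2 β.1
        + sgnK (trK (M2Of 3 (Lc ^ (n + 1 + 1)) (compMixG (ctrOff (3 + 1) Lc) Lc (n + 1 + 1)) 0 κ u β.2 β.1)))) x w (Sum.inl α) (Sum.inl α') with hF
  have hM : ∀ κ u, M2Z (Lc ^ (n + 1 + 1)) (tabsRecG Lc Pn n) (u, κ) β x w (Sum.inl α) (Sum.inl α') = F κ u := fun κ u => by
    rw [M2Z_tabsRecG, hF]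
  simp only [hM]
  -- every fine-bond sum is finite: the table's fine-bond window
  have hFsum : ∀ κ (g : Site (3 + 1) → ℝ), Summable fun u => g u * F κ u := fun κ g =>
    summable_of_ne_finset_zero (s := winF (Lc ^ (n + 1 + 1)) (wid Lc (n + 1 + 1)) β.1) fun u hu => by
      rw [hF]
      beta_reduce
      rw [compMixedT2G_even_inl_inl_eq_zero_of_bond (Lc ^ (n + 1 + 1)) 0 (n + 1 + 1) κ β.2 β.1 hu x w α α', mul_zero]
  -- swap the finite direction sum with the lattice sum, and recognise the lattice gradient `dz v`
  have hswap : (∑ κ : Fin (3 + 1), ∑' u : Site (3 + 1), (v (u + unitVec κ) - v u) * F κ u)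
      = ∑' u : Site (3 + 1), ∑ κ : Fin (3 + 1), dz v κ u * F κ u := by
    rw [Summable.tsum_finsetSum (fun κ _ => hFsum κ (fun u => dz v κ u))]
    rfl
  rw [hswap, tsum_sum_dz_mul_eq F hFsum v]
  -- the site law under the lattice sum
  have hsite : ∀ u : Site (3 + 1), (∑ κ : Fin (3 + 1), (F κ (u - unitVec κ) - F κ u))
      = ((if x = u then (1 : ℝ) else 0) - (if w = u then 1 else 0))
          * (-wM2 3 (Lc ^ (n + 1 + 1)) 0 * compVHKer (fun _ => symLinKerAt (ctr 4 Lc) Lc) (fun _ => symHessKerAt (ctr 4 Lc) Lc) Lc (n + 1 + 1) β.2 β.1 (α, x) (α', w)) :=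
    fun u => by
      rw [hF]
      exact sum_compMixedT2G_even_sub_inl_inl (Lc ^ (n + 1 + 1)) 0 (n + 1 + 1) β.2 β.1 u x w α α'
  simp only [hsite]
  -- the two indicators pick the sites `x` and `w`
  have hx : (∑' u : Site (3 + 1), v u * ((if x = u then (1 : ℝ) else 0)
        * (-wM2 3 (Lc ^ (n + 1 + 1)) 0 * compVHKer (fun _ => symLinKerAt (ctr 4 Lc) Lc) (fun _ => symHessKerAt (ctr 4 Lc) Lc) Lc (n + 1 + 1) β.2 β.1 (α, x) (α', w))))
      = v x * (-wM2 3 (Lc ^ (n + 1 + 1)) 0 * compVHKer (fun _ => symLinKerAt (ctr 4 Lc) Lc) (fun _ => symHessKerAt (ctr 4 Lc) Lc) Lc (n + 1 + 1) β.2 β.1 (α, x) (α', w)) := by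
    rw [tsum_eq_single x (fun u hu => by rw [if_neg (Ne.symm hu), zero_mul, mul_zero]), if_pos rfl, one_mul]
  have hw : (∑' u : Site (3 + 1), v u * ((if w = u then (1 : ℝ) else 0)
        * (-wM2 3 (Lc ^ (n + 1 + 1)) 0 * compVHKer (fun _ => symLinKerAt (ctr 4 Lc) Lc) (fun _ => symHessKerAt (ctr 4 Lc) Lc) Lc (n + 1 + 1) β.2 β.1 (α, x) (α', w))))
      = v w * (-wM2 3 (Lc ^ (n + 1 + 1)) 0 * compVHKer (fun _ => symLinKerAt (ctr 4 Lc) Lc) (fun _ => symHessKerAt (ctr 4 Lc) Lc) Lc (n + 1 + 1) β.2 β.1 (α, x) (α', w)) := by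
    rw [tsum_eq_single w (fun u hu => by rw [if_neg (Ne.symm hu), zero_mul, mul_zero]), if_pos rfl, one_mul]
  have hsx : Summable fun u : Site (3 + 1) => v u * ((if x = u then (1 : ℝ) else 0)
        * (-wM2 3 (Lc ^ (n + 1 + 1)) 0 * compVHKer (fun _ => symLinKerAt (ctr 4 Lc) Lc) (fun _ => symHessKerAt (ctr 4 Lc) Lc) Lc (n + 1 + 1) β.2 β.1 (α, x) (α', w))) :=
    summable_of_ne_finset_zero (s := {x}) fun u hu => by
      rw [Finset.mem_singleton] at hu
      rw [if_neg (Ne.symm hu), zero_mul, mul_zero]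
  have hsw : Summable fun u : Site (3 + 1) => v u * ((if w = u then (1 : ℝ) else 0)
        * (-wM2 3 (Lc ^ (n + 1 + 1)) 0 * compVHKer (fun _ => symLinKerAt (ctr 4 Lc) Lc) (fun _ => symHessKerAt (ctr 4 Lc) Lc) Lc (n + 1 + 1) β.2 β.1 (α, x) (α', w))) :=
    summable_of_ne_finset_zero (s := {w}) fun u hu => by
      rw [Finset.mem_singleton] at hu
      rw [if_neg (Ne.symm hu), zero_mul, mul_zero]
  have hsplit : (∑' u : Site (3 + 1), v u * (((if x = u then (1 : ℝ) else 0) - (if w = u then 1 else 0))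
        * (-wM2 3 (Lc ^ (n + 1 + 1)) 0 * compVHKer (fun _ => symLinKerAt (ctr 4 Lc) Lc) (fun _ => symHessKerAt (ctr 4 Lc) Lc) Lc (n + 1 + 1) β.2 β.1 (α, x) (α', w))))
      = (v x - v w) * (-wM2 3 (Lc ^ (n + 1 + 1)) 0 * compVHKer (fun _ => symLinKerAt (ctr 4 Lc) Lc) (fun _ => symHessKerAt (ctr 4 Lc) Lc) Lc (n + 1 + 1) β.2 β.1 (α, x) (α', w)) := by
    have : (fun u : Site (3 + 1) => v u * (((if x = u then (1 : ℝ) else 0) - (if w = u then 1 else 0))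
        * (-wM2 3 (Lc ^ (n + 1 + 1)) 0 * compVHKer (fun _ => symLinKerAt (ctr 4 Lc) Lc) (fun _ => symHessKerAt (ctr 4 Lc) Lc) Lc (n + 1 + 1) β.2 β.1 (α, x) (α', w))))
        = fun u => v u * ((if x = u then (1 : ℝ) else 0)
            * (-wM2 3 (Lc ^ (n + 1 + 1)) 0 * compVHKer (fun _ => symLinKerAt (ctr 4 Lc) Lc) (fun _ => symHessKerAt (ctr 4 Lc) Lc) Lc (n + 1 + 1) β.2 β.1 (α, x) (α', w)))
          - v u * ((if w = u then (1 : ℝ) else 0)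
            * (-wM2 3 (Lc ^ (n + 1 + 1)) 0 * compVHKer (fun _ => symLinKerAt (ctr 4 Lc) Lc) (fun _ => symHessKerAt (ctr 4 Lc) Lc) Lc (n + 1 + 1) β.2 β.1 (α, x) (α', w))) := by
      funext u; ring
    rw [this, hsx.tsum_sub hsw, hx, hw]
    ring
  rw [hsplit]
  ring

/-- [folklore] **`defKerZ_tabsRecG_eq_smul_comm` — ALL LEGS**: the defect kernel at the graded record is `(−wM2 − κ₂)` times the pure commutator kernel
`(x, w, inl α, inl α′) ↦ (v x − v w)·Ĉ_β(α,x;α′,w)` (zero on the multiplier legs). -/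
theorem defKerZ_tabsRecG_eq_smul_comm (κ₂ : ℝ) (v : Site (3 + 1) → ℝ) (β : Site (3 + 1) × Fin (3 + 1)) :
    defKerZ (Lc ^ (n + 1 + 1)) (tabsRecG Lc Pn n) κ₂ v β
      = fun x w a b => (-(wM2 3 (Lc ^ (n + 1 + 1)) 0) - κ₂) * Sum.elim
          (fun α : Fin (3 + 1) => Sum.elim
            (fun α' : Fin (3 + 1) => (v x - v w) * compVHKer (fun _ => symLinKerAt (ctr 4 Lc) Lc) (fun _ => symHessKerAt (ctr 4 Lc) Lc) Lc (n + 1 + 1) β.2 β.1 (α, x) (α', w))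
            (fun _ : Fin (3 + 1) => (0 : ℝ)) b)
          (fun _ : Fin (3 + 1) => (0 : ℝ)) a := by
  funext x w a b
  rcases a with α | m
  · rcases b with α' | m'
    · exact defKerZ_tabsRecG_inl_inl Pn n κ₂ v β x w α α'
    · rw [defKerZ_inr_right]; simp
  · rw [defKerZ_inr_left]; simp

/-- [folklore] **`defKerZ_tabsRecG_eq_zero` — AT THE LOCKED WEIGHT `κ₂ = −wM2 3 (Lc^(n+2)) 0` THE WARD-DEFECT KERNEL OF THE GRADED RECORD VANISHES IDENTICALLY**, for every
gauge function `v` and every window `β` (FINDING AN2-84-1 (ii) by name). -/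
theorem defKerZ_tabsRecG_eq_zero {κ₂ : ℝ} (hκ₂ : κ₂ = -(wM2 3 (Lc ^ (n + 1 + 1)) 0)) (v : Site (3 + 1) → ℝ) (β : Site (3 + 1) × Fin (3 + 1)) :
    defKerZ (Lc ^ (n + 1 + 1)) (tabsRecG Lc Pn n) κ₂ v β = fun _ _ _ _ => (0 : ℝ) := by
  rw [defKerZ_tabsRecG_eq_smul_comm, hκ₂, sub_self]
  funext x w a b
  rw [zero_mul]

/-! ## §3 The graded door vanishes at the locked weight -/

/-- [folklore] **`doorZ_tabsRecG_eq_zero` — THE DOOR OVER THE GRADED RECORD IS THE ZERO FAMILY at `κ₂ = −wM2 3 (Lc^(n+2)) 0`**, for ANY gauge-function family `lam`, ANY read-out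
weight `S` and ANY `κΔ`. -/
theorem doorZ_tabsRecG_eq_zero {κ₂ : ℝ} (hκ₂ : κ₂ = -(wM2 3 (Lc ^ (n + 1 + 1)) 0)) (κΔ : ℝ) (lam : Fin (3 + 1) → Site (3 + 1) → (Site (3 + 1) → ℝ))
    (S : Fin (3 + 1) → Site (3 + 1) → Fin (3 + 1) → Site (3 + 1) → ℝ) (μ : Fin (3 + 1)) (y : Site (3 + 1)) (ν : Fin (3 + 1)) (y' : Site (3 + 1)) :
    doorZ (Lc ^ (n + 1 + 1)) (tabsRecG Lc Pn n) κ₂ κΔ lam S μ y ν y' = fun _ _ _ _ => (0 : ℝ) := by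
  funext x w a b
  rw [doorZ_apply]
  simp only [defKerZ_tabsRecG_eq_zero Pn n hκ₂, mul_zero, add_zero, tsum_zero, Finset.sum_const_zero]

/-- [folklore] **`doorRecG_tabsRecG_succ_eq_zero` — v11's DOOR RECORD AT THE GRADED TABLES, member `n+1`, IS THE ZERO FAMILY when `κ₂ n = −wM2 3 (Lc^(n+2)) 0`**
(PART 87 `doorRecG_succ` + `doorZ_tabsRecG_eq_zero`; member `0` is `0` by PART 87's definition). -/
theorem doorRecG_tabsRecG_succ_eq_zero (Q : StepRows 3 Lc) (sn cS κ₂ κτ : ℕ → ℝ) (hκ₂ : κ₂ n = -(wM2 3 (Lc ^ (n + 1 + 1)) 0))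
    (μ : Fin (3 + 1)) (y : Site (3 + 1)) (ν : Fin (3 + 1)) (y' : Site (3 + 1)) :
    doorRecG Lc Q (tabsRecG Lc Pn) sn cS κ₂ κτ (n + 1) μ y ν y' = fun _ _ _ _ => (0 : ℝ) := by
  rw [doorRecG_succ]
  exact doorZ_tabsRecG_eq_zero Pn n hκ₂ (κτ n) (lamRecG Lc Q (sn n) n) (SRec Lc (cS n) n) μ y ν y'

end Summit.QuantumFields.BalabanUV.Beta.FP.TowerDoorDefectGraded

end
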